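/-
Copyright (c) 2026. All rights reserved.
Released under Apache 2.0 license as described in the file LICENSE.
-/
import Literature.Geometry.Kaehler.ComplexTorusQuaternionRamifiedIdealCRT
import Literature.Geometry.Kaehler.ComplexTorusQuaternionMaximalOrderNorms
import HarnessLib

/-!
# Eichler's Norm Theorem for the arithmetic progression at the RAMIFIED primes of `(−1,3)_ℚ`:
# `nrd(x + P₂) = nrd(x) + 2ℤ`, `nrd(x + P₃) = nrd(x) + 3ℤ`, `nrd(x + P₂P₃) = nrd(x) + 6ℤ` (norms coprime to the ideal)
# (Cerri–Chaubert–Lezowski 2014 Lemma 3.1 (iii) = Eichler 1938 Satz 5, for `Λ = O₆` and `I ∣ 𝔇(O₆) = P₂P₃`)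

[tag: complex_torus] [tag: abelian_surface] [tag: quaternion_multiplication] [tag: shimura_curve]
[tag: quaternion_order] [tag: maximal_order] [tag: reduced_norm] [tag: two_sided_ideal]

Lane `lit-hodgefound`, seat p12, row g34-#4 — THEOREMS ONLY (no definition, no named fact, no instance); the sequel of
g34-#1 `…EuclideanMinimum` (which proved only the inclusion `nrd(1 + P₂) ⊆ 1 + 2ℤ` that Lemma 3.7 uses, honest scope: «not
the equality») and of g34-#3 `…MaximalOrderTwoSidedIdeals` (the two-sided ideals of `O₆` are `q·{O₆, P₂, P₃, P₂P₃}`). Setting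
as there: `B = (−1,3)_ℚ`, `𝔬 = ℤ⟨1, i, j, ij⟩`, `O₆ = 𝔬 ∪ (e + 𝔬)` as the predicate `x ∈ 𝔬 ∨ x − e ∈ 𝔬`
(`e = ⟨1/2, 1/2, 1/2, −1/2⟩`), `nr x = re(x x̄)`; the primes above the ramified places, as predicates (g31-#3, g31-#5, g31-#6):
`P₂ = {y ∈ O₆ : 2 ∣ nr y} = (1 + i)O₆`, `P₃ = {y ∈ O₆ : 3 ∣ nr y} = μO₆`, `P₂P₃ = P₂ ∩ P₃ = {y ∈ O₆ : 6 ∣ nr y} = (δ)`;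
`O₆/P₂ ≅ 𝔽₄ = {0, 1, e, 1 + e}`, `O₆/P₃ ≅ 𝔽₉ = {r + si}`.

## The print, VERBATIM

* J.-P. Cerri, J. Chaubert, P. Lezowski (2014) [CerriChaubertLezowski2014] **Lemma 3.1** p. 189: «let `Λ` be a maximal
  order of `F`. Then: (i) `nrd_{F/K}(F) = K`. (ii) `nrd_{F/K}(Λ) = ℤ_K`. (iii) For any `x ∈ Λ` and any integral two-sided
  ideal `I` of `Λ` such that `nrd_{F/K}(x)ℤ_K` and `nrd_{F/K}(I)` are coprime, we have
  `nrd_{F/K}(x + I) = nrd_{F/K}(x) + I ∩ ℤ_K`. These properties are usually stated under the Eichler condition, but such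
  a generality is needless for us. Statement (iii) is Eichler's Norm Theorem for the arithmetic progression [6, Satz 5]; it
  implies (ii) which is also due to Eichler.»; proof of Lemma 3.7 p. 191–192: «let us denote by `P_i` the unique prime
  two-sided ideal of `Λ` lying above `p_i`. These ideals satisfy `p_iΛ = P_i²`, `P_i ∩ ℤ_K = p_i` and `P_iP_j = P_jP_i` …
  Moreover `nrd_{F/K}(P_i) = p_i`.»
* M.-F. Vignéras (1980) [VignerasLNM800] Ch. II §1 Cor. 1.7 / Lemme 1.8 (at a ramified place: `P = Ou`, `P² = Oπ`, residue
  field of degree `2`), Ch. III §5 A (e) (two-sided ideals of a maximal order generated by the ideals of `R` and the `P`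
  over ramified primes).
* S. Kudla, M. Rapoport, T. Yang (2006) [KudlaRapoportYang2006] §3.4 (3.4.19): «`O_B/(δ) ≅ ∏_{p∣D(B)} 𝔽_{p²}`».

Here `K = ℚ`, `Λ = O₆`, `nrd(P₂) = 2`, `nrd(P₃) = 3`, `nrd(P₂P₃) = 6`, `P₂ ∩ ℤ = 2ℤ`, `P₃ ∩ ℤ = 3ℤ`, `P₂P₃ ∩ ℤ = 6ℤ`; the
coprimality hypothesis reads `2 ∤ nr x`, `3 ∤ nr x`, `(nr x, 6) = 1`. (The ideals `nO₆·P` with `n > 1` involve the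
unramified primes — Eichler's theorem proper, via strong approximation — and are NOT treated.)

## What is proved

* §1 two norm-one units adapted to the two primes: `f = (1 + e)i = ⟨−½, 3/2, −½, −½⟩ ∈ O₆` with **`f³ = 1`**, `nr f = 1`,
  `f ≡ 1 (mod P₃)`, `f ≡ 1 + e (mod P₂)` — a generator of `(O₆/P₂)^× = 𝔽₄^×` invisible mod `P₃` —, and `i` with `i⁴ = 1`,
  `i ≡ 1 (mod P₂)`, `⟨i⟩ = ` the norm-one circle `{±1, ±i}` of `𝔽₉^×` (`units_f_i`, `primeThree_pow_f_sub_one`,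
  `primeTwo_pow_i_sub_one`); `P₃` is two-sided (`maxOrder_mul_primeThree`).
* §2 **TRANSPORT MOD `P₂`** (`exists_pow_f_congr_primeTwo`): for `x, z ∈ O₆` of odd norm there is `a ≤ 2` with
  `z·f^a ≡ x (mod P₂)` (the `3 × 3` table of `𝔽₄^×`).
* §3 **TRANSPORT MOD `P₃`** (`exists_pow_i_congr_primeThree`): for `x, z ∈ O₆` with `nr x ≡ nr z ≢ 0 (mod 3)` there is
  `b ≤ 3` with `z·i^b ≡ x (mod P₃)` (in `𝔽₉ = 𝔽₃(i)` two elements of the same non-zero norm differ by a factor in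
  `{±1, ±i}` — a `decide` over `(ℤ/3)⁴`).
* §4 **EICHLER'S NORM THEOREM AT `P₂`, `P₃`, `P₂P₃`** (Lemma 3.1 (iii) for these `I`), as equalities of sets of integers:
  for `x ∈ O₆` with `nr x = M`,
  **`{nr(x + y) : y ∈ P₂} = M + 2ℤ`** if `2 ∤ M` (`norm_add_primeTwo_eq`),
  **`{nr(x + y) : y ∈ P₃} = M + 3ℤ`** if `3 ∤ M` (`norm_add_primeThree_eq`),
  **`{nr(x + y) : y ∈ P₂P₃} = M + 6ℤ`** if `(M, 6) = 1` (`norm_add_primeSix_eq`).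
  `⊆`: `P₂ = {2 ∣ nr}` is additively closed, and `x ≡ r + si (mod P₃) ⟹ nr x ≡ r² + s² (mod 3)` (g31-#5); `⊇`: Lemma 3.1
  (ii) for `O₆` (g33-#3 `exists_maxOrder_norm_eq`: some `z ∈ O₆` has `nr z = n`) and the transports of §2–§3 — `z i^b f^a`
  has norm `n` and is `≡ x` modulo `P₂` and `P₃` (the two adjustments do not interfere: `f ≡ 1 (P₃)`, `i ≡ 1 (P₂)`).

## Honest scope

Only the three two-sided ideals dividing the different `𝔇(O₆) = P₂P₃ = (δ)` (and, trivially, `O₆` itself); for `I = nO₆`,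
`n > 1`, or `I = nP`, the statement `nrd(x + I) = nrd(x) + I ∩ ℤ` needs Eichler's theorem at the unramified primes
(strong approximation), which is not in the tree. Ideals are membership predicates, congruences are written `x − c ∈ P`;
no residue rings `O₆/P` are constructed (their arithmetic enters through g31-#3 / g31-#5 / g31-#6). 0 definitions,
0 named facts, 0 instances — net debt `0`.

## References
* [CerriChaubertLezowski2014] J.-P. Cerri, J. Chaubert, P. Lezowski, *Totally indefinite Euclidean quaternion fields*,
  Acta Arith. 165 (2014) 181–200, Lemma 3.1 (p. 189), Lemma 3.7 with proof (p. 191–192). doi:10.4064/aa165-2-4.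
* [Eichler1938] M. Eichler, *Allgemeine Kongruenzklasseneinteilungen der Ideale einfacher Algebren über algebraischen
  Zahlkörpern und ihre L-Reihen*, J. reine angew. Math. 179 (1938), Satz 5 (cited through [CerriChaubertLezowski2014, [6]]).
* [VignerasLNM800] M.-F. Vignéras, *Arithmétique des algèbres de quaternions*, LNM 800 (1980), Ch. II §1 Cor. 1.7,
  Lemme 1.8; Ch. III §5 A (e).
* [KudlaRapoportYang2006] S. Kudla, M. Rapoport, T. Yang, *Modular Forms and Special Cycles on Shimura Curves*, Ann. of
  Math. Stud. 161 (2006), §3.4 (3.4.19).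
-/

noncomputable section

set_option maxSynthPendingDepth 3

open Quaternion Function

namespace Literature.Geometry.Kaehler.ComplexTorus.QuaternionType

/-! ## §1 The units `f = (1 + e)i` (order `3`, `≡ 1 mod P₃`) and `i` (order `4`, `≡ 1 mod P₂`) -/

section Units

/-- `nr(xⁿ) = (nr x)ⁿ`. [cite: VignerasLNM800, Ch. I §1 (la norme réduite est multiplicative)] -/
private theorem norm_pow_eq' (x : ℍ[ℚ,((-1 : ℤ) : ℚ),((3 : ℤ) : ℚ)]) (n : ℕ) :
    (x ^ n * star (x ^ n)).re = ((x * star x).re) ^ n := by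
  induction n with
  | zero => rw [pow_zero, pow_zero, star_one, mul_one, QuaternionAlgebra.re_one]
  | succ n ih => rw [pow_succ, re_mul_mul_star_mul, ih, pow_succ]

/-- **The unit `f = (1 + e)i = ⟨−½, 3/2, −½, −½⟩ ∈ O₆`: `f³ = 1`, `nr f = 1`, `f − 1 ∈ P₃`, `f² − 1 ∈ P₃`, `f − (1 + e) ∈ P₂`;
and `i = ⟨0, 1, 0, 0⟩ ∈ 𝔬`: `i⁴ = 1`, `nr i = 1`, `i − 1 ∈ P₂`** — lifts to `O₆¹` of a generator of `𝔽₄^×` trivial in `𝔽₉`,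
and of a generator of the norm-one subgroup of `𝔽₉^×` trivial in `𝔽₄`. [cite: KudlaRapoportYang2006, §3.4 (3.4.19) («`O_B/(δ) ≅ ∏_{p∣D(B)} 𝔽_{p²}`»)] [cite: VignerasLNM800, Ch. II §1 Cor. 1.7 and Lemme 1.8] -/
theorem units_f_i :
    (((⟨-1/2, 3/2, -1/2, -1/2⟩ : ℍ[ℚ,((-1 : ℤ) : ℚ),((3 : ℤ) : ℚ)]) ∈ order (-1) 3 ∨
        (⟨-1/2, 3/2, -1/2, -1/2⟩ : ℍ[ℚ,((-1 : ℤ) : ℚ),((3 : ℤ) : ℚ)]) - ⟨1/2, 1/2, 1/2, -1/2⟩ ∈ order (-1) 3) ∧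
      (⟨-1/2, 3/2, -1/2, -1/2⟩ : ℍ[ℚ,((-1 : ℤ) : ℚ),((3 : ℤ) : ℚ)]) ^ 3 = 1 ∧
      ((⟨-1/2, 3/2, -1/2, -1/2⟩ : ℍ[ℚ,((-1 : ℤ) : ℚ),((3 : ℤ) : ℚ)]) * star ⟨-1/2, 3/2, -1/2, -1/2⟩).re = 1 ∧
      (((⟨-1/2, 3/2, -1/2, -1/2⟩ : ℍ[ℚ,((-1 : ℤ) : ℚ),((3 : ℤ) : ℚ)]) - 1 ∈ order (-1) 3 ∨
          (⟨-1/2, 3/2, -1/2, -1/2⟩ : ℍ[ℚ,((-1 : ℤ) : ℚ),((3 : ℤ) : ℚ)]) - 1 - ⟨1/2, 1/2, 1/2, -1/2⟩ ∈ order (-1) 3) ∧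
        ∃ N : ℤ, ((((⟨-1/2, 3/2, -1/2, -1/2⟩ : ℍ[ℚ,((-1 : ℤ) : ℚ),((3 : ℤ) : ℚ)]) - 1) *
          star ((⟨-1/2, 3/2, -1/2, -1/2⟩ : ℍ[ℚ,((-1 : ℤ) : ℚ),((3 : ℤ) : ℚ)]) - 1)).re) = 3 * N) ∧
      (((⟨-1/2, 3/2, -1/2, -1/2⟩ : ℍ[ℚ,((-1 : ℤ) : ℚ),((3 : ℤ) : ℚ)]) - (1 + ⟨1/2, 1/2, 1/2, -1/2⟩) ∈ order (-1) 3 ∨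
          (⟨-1/2, 3/2, -1/2, -1/2⟩ : ℍ[ℚ,((-1 : ℤ) : ℚ),((3 : ℤ) : ℚ)]) - (1 + ⟨1/2, 1/2, 1/2, -1/2⟩) -
            ⟨1/2, 1/2, 1/2, -1/2⟩ ∈ order (-1) 3) ∧
        ∃ N : ℤ, ((((⟨-1/2, 3/2, -1/2, -1/2⟩ : ℍ[ℚ,((-1 : ℤ) : ℚ),((3 : ℤ) : ℚ)]) - (1 + ⟨1/2, 1/2, 1/2, -1/2⟩)) *
          star ((⟨-1/2, 3/2, -1/2, -1/2⟩ : ℍ[ℚ,((-1 : ℤ) : ℚ),((3 : ℤ) : ℚ)]) - (1 + ⟨1/2, 1/2, 1/2, -1/2⟩))).re) = 2 * N)) ∧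
    ((⟨0, 1, 0, 0⟩ : ℍ[ℚ,((-1 : ℤ) : ℚ),((3 : ℤ) : ℚ)]) ∈ order (-1) 3 ∧
      (⟨0, 1, 0, 0⟩ : ℍ[ℚ,((-1 : ℤ) : ℚ),((3 : ℤ) : ℚ)]) ^ 4 = 1 ∧
      ((⟨0, 1, 0, 0⟩ : ℍ[ℚ,((-1 : ℤ) : ℚ),((3 : ℤ) : ℚ)]) * star ⟨0, 1, 0, 0⟩).re = 1 ∧
      (((⟨0, 1, 0, 0⟩ : ℍ[ℚ,((-1 : ℤ) : ℚ),((3 : ℤ) : ℚ)]) - 1 ∈ order (-1) 3 ∨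
          (⟨0, 1, 0, 0⟩ : ℍ[ℚ,((-1 : ℤ) : ℚ),((3 : ℤ) : ℚ)]) - 1 - ⟨1/2, 1/2, 1/2, -1/2⟩ ∈ order (-1) 3) ∧
        ∃ N : ℤ, ((((⟨0, 1, 0, 0⟩ : ℍ[ℚ,((-1 : ℤ) : ℚ),((3 : ℤ) : ℚ)]) - 1) *
          star ((⟨0, 1, 0, 0⟩ : ℍ[ℚ,((-1 : ℤ) : ℚ),((3 : ℤ) : ℚ)]) - 1)).re) = 2 * N)) := by
  have h1 : (1 : ℍ[ℚ,((-1 : ℤ) : ℚ),((3 : ℤ) : ℚ)]) = ⟨1, 0, 0, 0⟩ := rfl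
  -- the differences, as explicit quaternions
  have d1 : (⟨-1/2, 3/2, -1/2, -1/2⟩ : ℍ[ℚ,((-1 : ℤ) : ℚ),((3 : ℤ) : ℚ)]) - ⟨1/2, 1/2, 1/2, -1/2⟩ = ⟨-1, 1, -1, 0⟩ := by
    rw [QuaternionAlgebra.mk_sub_mk]; ext <;> norm_num
  have d2 : (⟨-1/2, 3/2, -1/2, -1/2⟩ : ℍ[ℚ,((-1 : ℤ) : ℚ),((3 : ℤ) : ℚ)]) - 1 = ⟨-3/2, 3/2, -1/2, -1/2⟩ := by
    rw [h1, QuaternionAlgebra.mk_sub_mk]; ext <;> norm_num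
  have d3 : (⟨-3/2, 3/2, -1/2, -1/2⟩ : ℍ[ℚ,((-1 : ℤ) : ℚ),((3 : ℤ) : ℚ)]) - ⟨1/2, 1/2, 1/2, -1/2⟩ = ⟨-2, 1, -1, 0⟩ := by
    rw [QuaternionAlgebra.mk_sub_mk]; ext <;> norm_num
  have d4 : (⟨-1/2, 3/2, -1/2, -1/2⟩ : ℍ[ℚ,((-1 : ℤ) : ℚ),((3 : ℤ) : ℚ)]) - (1 + ⟨1/2, 1/2, 1/2, -1/2⟩) = ⟨-2, 1, -1, 0⟩ := by
    rw [h1, QuaternionAlgebra.mk_add_mk, QuaternionAlgebra.mk_sub_mk]; ext <;> norm_num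
  have d5 : (⟨0, 1, 0, 0⟩ : ℍ[ℚ,((-1 : ℤ) : ℚ),((3 : ℤ) : ℚ)]) - 1 = ⟨-1, 1, 0, 0⟩ := by
    rw [h1, QuaternionAlgebra.mk_sub_mk]; ext <;> norm_num
  refine ⟨⟨Or.inr ⟨![-1, 1, -1, 0], by rw [d1]; ext <;> simp [ofCoords]⟩, ?_, ?_,
      ⟨Or.inr ⟨![-2, 1, -1, 0], by rw [d2, d3]; ext <;> simp [ofCoords]⟩, 1, ?_⟩,
      ⟨Or.inl ⟨![-2, 1, -1, 0], by rw [d4]; ext <;> simp [ofCoords]⟩, 1, ?_⟩⟩,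
    ⟨⟨![0, 1, 0, 0], by ext <;> simp [ofCoords]⟩, ?_, ?_, ⟨Or.inl ⟨![-1, 1, 0, 0], by rw [d5]; ext <;> simp [ofCoords]⟩, 1, ?_⟩⟩⟩
  · rw [pow_succ, pow_two, QuaternionAlgebra.mk_mul_mk, QuaternionAlgebra.mk_mul_mk, h1]; ext <;> norm_num
  · rw [QuaternionAlgebra.star_mk, QuaternionAlgebra.mk_mul_mk]; norm_num
  · rw [d2, QuaternionAlgebra.star_mk, QuaternionAlgebra.mk_mul_mk]; norm_num
  · rw [d4, QuaternionAlgebra.star_mk, QuaternionAlgebra.mk_mul_mk]; norm_num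
  · rw [show (4 : ℕ) = 2 + 2 from rfl, pow_add, pow_two, QuaternionAlgebra.mk_mul_mk, QuaternionAlgebra.mk_mul_mk, h1]
    ext <;> norm_num
  · rw [QuaternionAlgebra.star_mk, QuaternionAlgebra.mk_mul_mk]; norm_num
  · rw [d5, QuaternionAlgebra.star_mk, QuaternionAlgebra.mk_mul_mk]; norm_num

/-- Powers of `f` and of `i` lie in `O₆` and have norm `1`. [cite: VignerasLNM800, Ch. I §4 (unités)] -/
theorem pow_f_i_maxOrder_normOne (a b : ℕ) :
    (((⟨-1/2, 3/2, -1/2, -1/2⟩ : ℍ[ℚ,((-1 : ℤ) : ℚ),((3 : ℤ) : ℚ)]) ^ a ∈ order (-1) 3 ∨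
        (⟨-1/2, 3/2, -1/2, -1/2⟩ : ℍ[ℚ,((-1 : ℤ) : ℚ),((3 : ℤ) : ℚ)]) ^ a - ⟨1/2, 1/2, 1/2, -1/2⟩ ∈ order (-1) 3) ∧
      (((⟨-1/2, 3/2, -1/2, -1/2⟩ : ℍ[ℚ,((-1 : ℤ) : ℚ),((3 : ℤ) : ℚ)]) ^ a) *
        star (((⟨-1/2, 3/2, -1/2, -1/2⟩ : ℍ[ℚ,((-1 : ℤ) : ℚ),((3 : ℤ) : ℚ)]) ^ a))).re = 1) ∧
    ((⟨0, 1, 0, 0⟩ : ℍ[ℚ,((-1 : ℤ) : ℚ),((3 : ℤ) : ℚ)]) ^ b ∈ order (-1) 3 ∧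
      (((⟨0, 1, 0, 0⟩ : ℍ[ℚ,((-1 : ℤ) : ℚ),((3 : ℤ) : ℚ)]) ^ b) *
        star (((⟨0, 1, 0, 0⟩ : ℍ[ℚ,((-1 : ℤ) : ℚ),((3 : ℤ) : ℚ)]) ^ b))).re = 1) := by
  obtain ⟨⟨hf, -, hfn, -⟩, ⟨hi, -, hin, -⟩⟩ := units_f_i
  refine ⟨⟨?_, by rw [norm_pow_eq', hfn, one_pow]⟩, ⟨Subring.pow_mem _ hi b, by rw [norm_pow_eq', hin, one_pow]⟩⟩
  induction a with
  | zero => exact Or.inl (by rw [pow_zero]; exact Subring.one_mem _)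
  | succ n ih => rw [pow_succ]; exact maxOrder_mul ih hf

/-- **`f^a ≡ 1 (mod P₃)`** for every `a` (`f ≡ 1`, classes multiply). [cite: VignerasLNM800, Ch. II §1 Lemme 1.5 and Ch. IV §1 (réduction `O → O/I`)] -/
theorem primeThree_pow_f_sub_one (a : ℕ) :
    ((⟨-1/2, 3/2, -1/2, -1/2⟩ : ℍ[ℚ,((-1 : ℤ) : ℚ),((3 : ℤ) : ℚ)]) ^ a - 1 ∈ order (-1) 3 ∨
        (⟨-1/2, 3/2, -1/2, -1/2⟩ : ℍ[ℚ,((-1 : ℤ) : ℚ),((3 : ℤ) : ℚ)]) ^ a - 1 - ⟨1/2, 1/2, 1/2, -1/2⟩ ∈ order (-1) 3) ∧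
      ∃ N : ℤ, (((⟨-1/2, 3/2, -1/2, -1/2⟩ : ℍ[ℚ,((-1 : ℤ) : ℚ),((3 : ℤ) : ℚ)]) ^ a - 1) *
        star ((⟨-1/2, 3/2, -1/2, -1/2⟩ : ℍ[ℚ,((-1 : ℤ) : ℚ),((3 : ℤ) : ℚ)]) ^ a - 1)).re = 3 * N := by
  obtain ⟨⟨hf, -, -, hf3, -⟩, -⟩ := units_f_i
  induction a with
  | zero =>
    refine ⟨Or.inl (by rw [pow_zero, sub_self]; exact Subring.zero_mem _), 0, ?_⟩
    rw [pow_zero, sub_self, zero_mul, QuaternionAlgebra.re_zero]; norm_num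
  | succ n ih =>
    -- `f^{n+1} − 1 = (f^n − 1)·f + (f − 1)`
    have e : (⟨-1/2, 3/2, -1/2, -1/2⟩ : ℍ[ℚ,((-1 : ℤ) : ℚ),((3 : ℤ) : ℚ)]) ^ (n + 1) - 1 =
        ((⟨-1/2, 3/2, -1/2, -1/2⟩ : ℍ[ℚ,((-1 : ℤ) : ℚ),((3 : ℤ) : ℚ)]) ^ n - 1) * ⟨-1/2, 3/2, -1/2, -1/2⟩ +
          ((⟨-1/2, 3/2, -1/2, -1/2⟩ : ℍ[ℚ,((-1 : ℤ) : ℚ),((3 : ℤ) : ℚ)]) - 1) := by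
      rw [pow_succ]; noncomm_ring
    rw [e]
    obtain ⟨y, hy, hye⟩ := (primeThree_iff_exists_mu_mul _).1 ih
    refine primeThree_add ((primeThree_iff_exists_mu_mul _).2 ⟨y * ⟨-1/2, 3/2, -1/2, -1/2⟩, maxOrder_mul hy hf, ?_⟩) hf3
    rw [hye, mul_assoc]

/-- **`i^b ≡ 1 (mod P₂)`** for every `b` (`i ≡ 1`, classes multiply). [cite: VignerasLNM800, Ch. II §1 Lemme 1.5] [cite: BayerTravesa2007, §1 p. 317 («mod 2»)] -/
theorem primeTwo_pow_i_sub_one (b : ℕ) :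
    ((⟨0, 1, 0, 0⟩ : ℍ[ℚ,((-1 : ℤ) : ℚ),((3 : ℤ) : ℚ)]) ^ b - 1 ∈ order (-1) 3 ∨
        (⟨0, 1, 0, 0⟩ : ℍ[ℚ,((-1 : ℤ) : ℚ),((3 : ℤ) : ℚ)]) ^ b - 1 - ⟨1/2, 1/2, 1/2, -1/2⟩ ∈ order (-1) 3) ∧
      ∃ N : ℤ, (((⟨0, 1, 0, 0⟩ : ℍ[ℚ,((-1 : ℤ) : ℚ),((3 : ℤ) : ℚ)]) ^ b - 1) *
        star ((⟨0, 1, 0, 0⟩ : ℍ[ℚ,((-1 : ℤ) : ℚ),((3 : ℤ) : ℚ)]) ^ b - 1)).re = 2 * N := by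
  obtain ⟨-, hi, -, -, hi2⟩ := units_f_i
  induction b with
  | zero =>
    refine ⟨Or.inl (by rw [pow_zero, sub_self]; exact Subring.zero_mem _), 0, ?_⟩
    rw [pow_zero, sub_self, zero_mul, QuaternionAlgebra.re_zero]; norm_num
  | succ n ih =>
    have e : (⟨0, 1, 0, 0⟩ : ℍ[ℚ,((-1 : ℤ) : ℚ),((3 : ℤ) : ℚ)]) ^ (n + 1) - 1 =
        ((⟨0, 1, 0, 0⟩ : ℍ[ℚ,((-1 : ℤ) : ℚ),((3 : ℤ) : ℚ)]) ^ n - 1) * ⟨0, 1, 0, 0⟩ +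
          ((⟨0, 1, 0, 0⟩ : ℍ[ℚ,((-1 : ℤ) : ℚ),((3 : ℤ) : ℚ)]) - 1) := by
      rw [pow_succ]; noncomm_ring
    rw [e]
    exact primeTwo_add (maxOrder_mul_primeTwo (Or.inl hi) ih).2 hi2

/-- **`P₃ = μO₆ = O₆μ` is two-sided**: `O₆·P₃ ⊆ P₃` and `P₃·O₆ ⊆ P₃`. [cite: VignerasLNM800, Ch. II §1 Lemme 1.5 and Ch. III §5 A (e)] [cite: Ogg1983RealPoints, §2 p. 283 («`μ𝒪 = 𝒪μ`»)] -/
theorem maxOrder_mul_primeThree {x y : ℍ[ℚ,((-1 : ℤ) : ℚ),((3 : ℤ) : ℚ)]}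
    (hx : x ∈ order (-1) 3 ∨ x - ⟨1/2, 1/2, 1/2, -1/2⟩ ∈ order (-1) 3)
    (hy : (y ∈ order (-1) 3 ∨ y - ⟨1/2, 1/2, 1/2, -1/2⟩ ∈ order (-1) 3) ∧ ∃ N : ℤ, (y * star y).re = 3 * N) :
    ((x * y ∈ order (-1) 3 ∨ x * y - ⟨1/2, 1/2, 1/2, -1/2⟩ ∈ order (-1) 3) ∧
        ∃ N : ℤ, ((x * y) * star (x * y)).re = 3 * N) ∧
      ((y * x ∈ order (-1) 3 ∨ y * x - ⟨1/2, 1/2, 1/2, -1/2⟩ ∈ order (-1) 3) ∧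
        ∃ N : ℤ, ((y * x) * star (y * x)).re = 3 * N) := by
  constructor
  · obtain ⟨y', hy', rfl⟩ := (primeThree_iff_exists_mul_mu y).1 hy
    rw [← mul_assoc]
    exact (primeThree_iff_exists_mul_mu _).2 ⟨x * y', maxOrder_mul hx hy', rfl⟩
  · obtain ⟨y', hy', rfl⟩ := (primeThree_iff_exists_mu_mul y).1 hy
    rw [mul_assoc]
    exact (primeThree_iff_exists_mu_mul _).2 ⟨y' * x, maxOrder_mul hy' hx, rfl⟩

end Units

/-! ## §2 Transport modulo `P₂` by powers of `f` -/

section TransportTwo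

/-- **TRANSPORT MOD `P₂`: for `x, z ∈ O₆` of ODD norm there is `a ≤ 2` with `z·f^a − x ∈ P₂`** (`f = (1 + e)i` generates
`(O₆/P₂)^× = 𝔽₄^× = {1, e, 1 + e}`: both `x` and `z` are units mod `P₂`, and `z·f^a` runs through the three classes; the
nine entries `c·f^a − c′`, `c, c′ ∈ {1, e, 1 + e}`, are explicit members of `𝔬` with even coordinate sum).
[cite: VignerasLNM800, Ch. II §1 Cor. 1.7 and Lemme 1.8 (residue field `𝔽₄` at the ramified prime `2`)] [cite: KudlaRapoportYang2006, §3.4 (3.4.19)] -/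
theorem exists_pow_f_congr_primeTwo {x z : ℍ[ℚ,((-1 : ℤ) : ℚ),((3 : ℤ) : ℚ)]}
    (hx : x ∈ order (-1) 3 ∨ x - ⟨1/2, 1/2, 1/2, -1/2⟩ ∈ order (-1) 3) (hxM : ∃ M : ℤ, (x * star x).re = 2 * M + 1)
    (hz : z ∈ order (-1) 3 ∨ z - ⟨1/2, 1/2, 1/2, -1/2⟩ ∈ order (-1) 3) (hzM : ∃ M : ℤ, (z * star z).re = 2 * M + 1) :
    ∃ a : ℕ, a ≤ 2 ∧
      ((z * (⟨-1/2, 3/2, -1/2, -1/2⟩ : ℍ[ℚ,((-1 : ℤ) : ℚ),((3 : ℤ) : ℚ)]) ^ a - x ∈ order (-1) 3 ∨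
          z * (⟨-1/2, 3/2, -1/2, -1/2⟩ : ℍ[ℚ,((-1 : ℤ) : ℚ),((3 : ℤ) : ℚ)]) ^ a - x - ⟨1/2, 1/2, 1/2, -1/2⟩ ∈ order (-1) 3) ∧
        ∃ N : ℤ, ((z * (⟨-1/2, 3/2, -1/2, -1/2⟩ : ℍ[ℚ,((-1 : ℤ) : ℚ),((3 : ℤ) : ℚ)]) ^ a - x) *
          star (z * (⟨-1/2, 3/2, -1/2, -1/2⟩ : ℍ[ℚ,((-1 : ℤ) : ℚ),((3 : ℤ) : ℚ)]) ^ a - x)).re = 2 * N) := by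
  have h1 : (1 : ℍ[ℚ,((-1 : ℤ) : ℚ),((3 : ℤ) : ℚ)]) = ⟨1, 0, 0, 0⟩ := rfl
  have hf2 : (⟨-1/2, 3/2, -1/2, -1/2⟩ : ℍ[ℚ,((-1 : ℤ) : ℚ),((3 : ℤ) : ℚ)]) ^ 2 = ⟨-1/2, -3/2, 1/2, 1/2⟩ := by
    rw [pow_two, QuaternionAlgebra.mk_mul_mk]; ext <;> norm_num
  -- an explicit member of `𝔬` with even coordinate sum lies in `P₂`
  have mem : ∀ a b c d : ℤ, 2 ∣ a + b + c + d →
      (((⟨(a : ℚ), (b : ℚ), (c : ℚ), (d : ℚ)⟩ : ℍ[ℚ,((-1 : ℤ) : ℚ),((3 : ℤ) : ℚ)]) ∈ order (-1) 3 ∨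
          (⟨(a : ℚ), (b : ℚ), (c : ℚ), (d : ℚ)⟩ : ℍ[ℚ,((-1 : ℤ) : ℚ),((3 : ℤ) : ℚ)]) - ⟨1/2, 1/2, 1/2, -1/2⟩ ∈ order (-1) 3) ∧
        ∃ N : ℤ, (((⟨(a : ℚ), (b : ℚ), (c : ℚ), (d : ℚ)⟩ : ℍ[ℚ,((-1 : ℤ) : ℚ),((3 : ℤ) : ℚ)]) *
          star (⟨(a : ℚ), (b : ℚ), (c : ℚ), (d : ℚ)⟩ : ℍ[ℚ,((-1 : ℤ) : ℚ),((3 : ℤ) : ℚ)])).re = 2 * N)) := by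
    intro a b c d hs
    refine (primeTwo_iff _).2 ⟨![a, b, c, d], by ext <;> simp [ofCoords], ?_⟩
    simpa using hs
  have hodd : ∀ {y : ℍ[ℚ,((-1 : ℤ) : ℚ),((3 : ℤ) : ℚ)]}, (∃ M : ℤ, (y * star y).re = 2 * M + 1) → ¬ ∃ N : ℤ, (y * star y).re = 2 * N := by
    rintro y ⟨M, hM⟩ ⟨N, hN⟩
    have : (2 * M + 1 : ℤ) = 2 * N := by exact_mod_cast hM.symm.trans hN
    omega
  have hfO : ∀ a : ℕ, (⟨-1/2, 3/2, -1/2, -1/2⟩ : ℍ[ℚ,((-1 : ℤ) : ℚ),((3 : ℤ) : ℚ)]) ^ a ∈ order (-1) 3 ∨ (⟨-1/2, 3/2, -1/2, -1/2⟩ : ℍ[ℚ,((-1 : ℤ) : ℚ),((3 : ℤ) : ℚ)]) ^ a - ⟨1/2, 1/2, 1/2, -1/2⟩ ∈ order (-1) 3 :=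
    fun a ↦ (pow_f_i_maxOrder_normOne a 0).1.1
  -- assembling `z f^a − x = (z − c_z) f^a + (c_z f^a − c_x) − (x − c_x)`
  have assemble : ∀ (cz cx : ℍ[ℚ,((-1 : ℤ) : ℚ),((3 : ℤ) : ℚ)]) (a : ℕ),
      ((z - cz ∈ order (-1) 3 ∨ z - cz - ⟨1/2, 1/2, 1/2, -1/2⟩ ∈ order (-1) 3) ∧ ∃ N : ℤ, ((z - cz) * star (z - cz)).re = 2 * N) →
      ((x - cx ∈ order (-1) 3 ∨ x - cx - ⟨1/2, 1/2, 1/2, -1/2⟩ ∈ order (-1) 3) ∧ ∃ N : ℤ, ((x - cx) * star (x - cx)).re = 2 * N) →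
      ((cz * (⟨-1/2, 3/2, -1/2, -1/2⟩ : ℍ[ℚ,((-1 : ℤ) : ℚ),((3 : ℤ) : ℚ)]) ^ a - cx ∈ order (-1) 3 ∨ cz * (⟨-1/2, 3/2, -1/2, -1/2⟩ : ℍ[ℚ,((-1 : ℤ) : ℚ),((3 : ℤ) : ℚ)]) ^ a - cx - ⟨1/2, 1/2, 1/2, -1/2⟩ ∈ order (-1) 3) ∧
        ∃ N : ℤ, ((cz * (⟨-1/2, 3/2, -1/2, -1/2⟩ : ℍ[ℚ,((-1 : ℤ) : ℚ),((3 : ℤ) : ℚ)]) ^ a - cx) * star (cz * (⟨-1/2, 3/2, -1/2, -1/2⟩ : ℍ[ℚ,((-1 : ℤ) : ℚ),((3 : ℤ) : ℚ)]) ^ a - cx)).re = 2 * N) →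
      ((z * (⟨-1/2, 3/2, -1/2, -1/2⟩ : ℍ[ℚ,((-1 : ℤ) : ℚ),((3 : ℤ) : ℚ)]) ^ a - x ∈ order (-1) 3 ∨ z * (⟨-1/2, 3/2, -1/2, -1/2⟩ : ℍ[ℚ,((-1 : ℤ) : ℚ),((3 : ℤ) : ℚ)]) ^ a - x - ⟨1/2, 1/2, 1/2, -1/2⟩ ∈ order (-1) 3) ∧
        ∃ N : ℤ, ((z * (⟨-1/2, 3/2, -1/2, -1/2⟩ : ℍ[ℚ,((-1 : ℤ) : ℚ),((3 : ℤ) : ℚ)]) ^ a - x) * star (z * (⟨-1/2, 3/2, -1/2, -1/2⟩ : ℍ[ℚ,((-1 : ℤ) : ℚ),((3 : ℤ) : ℚ)]) ^ a - x)).re = 2 * N) := by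
    intro cz cx a hzc hxc htab
    have e : z * (⟨-1/2, 3/2, -1/2, -1/2⟩ : ℍ[ℚ,((-1 : ℤ) : ℚ),((3 : ℤ) : ℚ)]) ^ a - x =
        (z - cz) * (⟨-1/2, 3/2, -1/2, -1/2⟩ : ℍ[ℚ,((-1 : ℤ) : ℚ),((3 : ℤ) : ℚ)]) ^ a + (cz * (⟨-1/2, 3/2, -1/2, -1/2⟩ : ℍ[ℚ,((-1 : ℤ) : ℚ),((3 : ℤ) : ℚ)]) ^ a - cx) + -(x - cx) := by
      noncomm_ring
    rw [e]
    exact primeTwo_add (primeTwo_add (maxOrder_mul_primeTwo (hfO a) hzc).2 htab) (primeTwo_neg hxc)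
  -- the nine table entries `c_z f^a − c_x ∈ P₂`
  have t11 := assemble 1 1 0
  have t1e := assemble 1 ⟨1/2, 1/2, 1/2, -1/2⟩ 2
  have t1f := assemble 1 (⟨1/2, 1/2, 1/2, -1/2⟩ + 1) 1
  have te1 := assemble ⟨1/2, 1/2, 1/2, -1/2⟩ 1 1
  have tee := assemble ⟨1/2, 1/2, 1/2, -1/2⟩ ⟨1/2, 1/2, 1/2, -1/2⟩ 0
  have tef := assemble ⟨1/2, 1/2, 1/2, -1/2⟩ (⟨1/2, 1/2, 1/2, -1/2⟩ + 1) 2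
  have tf1 := assemble (⟨1/2, 1/2, 1/2, -1/2⟩ + 1) 1 2
  have tfe := assemble (⟨1/2, 1/2, 1/2, -1/2⟩ + 1) ⟨1/2, 1/2, 1/2, -1/2⟩ 1
  have tff := assemble (⟨1/2, 1/2, 1/2, -1/2⟩ + 1) (⟨1/2, 1/2, 1/2, -1/2⟩ + 1) 0
  have v11 : (1 : ℍ[ℚ,((-1 : ℤ) : ℚ),((3 : ℤ) : ℚ)]) * (⟨-1/2, 3/2, -1/2, -1/2⟩ : ℍ[ℚ,((-1 : ℤ) : ℚ),((3 : ℤ) : ℚ)]) ^ 0 - 1 = ⟨((0 : ℤ) : ℚ), ((0 : ℤ) : ℚ), ((0 : ℤ) : ℚ), ((0 : ℤ) : ℚ)⟩ := by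
    rw [pow_zero, mul_one, sub_self]; ext <;> norm_num
  have v1e : (1 : ℍ[ℚ,((-1 : ℤ) : ℚ),((3 : ℤ) : ℚ)]) * (⟨-1/2, 3/2, -1/2, -1/2⟩ : ℍ[ℚ,((-1 : ℤ) : ℚ),((3 : ℤ) : ℚ)]) ^ 2 - ⟨1/2, 1/2, 1/2, -1/2⟩ = ⟨((-1 : ℤ) : ℚ), ((-2 : ℤ) : ℚ), ((0 : ℤ) : ℚ), ((1 : ℤ) : ℚ)⟩ := by
    rw [hf2, one_mul, QuaternionAlgebra.mk_sub_mk]; ext <;> norm_num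
  have v1f : (1 : ℍ[ℚ,((-1 : ℤ) : ℚ),((3 : ℤ) : ℚ)]) * (⟨-1/2, 3/2, -1/2, -1/2⟩ : ℍ[ℚ,((-1 : ℤ) : ℚ),((3 : ℤ) : ℚ)]) ^ 1 - (⟨1/2, 1/2, 1/2, -1/2⟩ + 1) =
      ⟨((-2 : ℤ) : ℚ), ((1 : ℤ) : ℚ), ((-1 : ℤ) : ℚ), ((0 : ℤ) : ℚ)⟩ := by
    rw [pow_one, one_mul, h1, QuaternionAlgebra.mk_add_mk, QuaternionAlgebra.mk_sub_mk]; ext <;> norm_num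
  have ve1 : (⟨1/2, 1/2, 1/2, -1/2⟩ : ℍ[ℚ,((-1 : ℤ) : ℚ),((3 : ℤ) : ℚ)]) * (⟨-1/2, 3/2, -1/2, -1/2⟩ : ℍ[ℚ,((-1 : ℤ) : ℚ),((3 : ℤ) : ℚ)]) ^ 1 - 1 =
      ⟨((-2 : ℤ) : ℚ), ((2 : ℤ) : ℚ), ((-1 : ℤ) : ℚ), ((-1 : ℤ) : ℚ)⟩ := by
    rw [pow_one, h1, QuaternionAlgebra.mk_mul_mk, QuaternionAlgebra.mk_sub_mk]; ext <;> norm_num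
  have vee : (⟨1/2, 1/2, 1/2, -1/2⟩ : ℍ[ℚ,((-1 : ℤ) : ℚ),((3 : ℤ) : ℚ)]) * (⟨-1/2, 3/2, -1/2, -1/2⟩ : ℍ[ℚ,((-1 : ℤ) : ℚ),((3 : ℤ) : ℚ)]) ^ 0 - ⟨1/2, 1/2, 1/2, -1/2⟩ = ⟨((0 : ℤ) : ℚ), ((0 : ℤ) : ℚ), ((0 : ℤ) : ℚ), ((0 : ℤ) : ℚ)⟩ := by
    rw [pow_zero, mul_one, sub_self]; ext <;> norm_num
  have vef : (⟨1/2, 1/2, 1/2, -1/2⟩ : ℍ[ℚ,((-1 : ℤ) : ℚ),((3 : ℤ) : ℚ)]) * (⟨-1/2, 3/2, -1/2, -1/2⟩ : ℍ[ℚ,((-1 : ℤ) : ℚ),((3 : ℤ) : ℚ)]) ^ 2 - (⟨1/2, 1/2, 1/2, -1/2⟩ + 1) =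
      ⟨((-1 : ℤ) : ℚ), ((-3 : ℤ) : ℚ), ((0 : ℤ) : ℚ), ((2 : ℤ) : ℚ)⟩ := by
    rw [hf2, h1, QuaternionAlgebra.mk_mul_mk, QuaternionAlgebra.mk_add_mk, QuaternionAlgebra.mk_sub_mk]; ext <;> norm_num
  have vf1 : (⟨1/2, 1/2, 1/2, -1/2⟩ + 1 : ℍ[ℚ,((-1 : ℤ) : ℚ),((3 : ℤ) : ℚ)]) * (⟨-1/2, 3/2, -1/2, -1/2⟩ : ℍ[ℚ,((-1 : ℤ) : ℚ),((3 : ℤ) : ℚ)]) ^ 2 - 1 =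
      ⟨((-1 : ℤ) : ℚ), ((-4 : ℤ) : ℚ), ((1 : ℤ) : ℚ), ((2 : ℤ) : ℚ)⟩ := by
    rw [hf2, h1, QuaternionAlgebra.mk_add_mk, QuaternionAlgebra.mk_mul_mk, QuaternionAlgebra.mk_sub_mk]; ext <;> norm_num
  have vfe : (⟨1/2, 1/2, 1/2, -1/2⟩ + 1 : ℍ[ℚ,((-1 : ℤ) : ℚ),((3 : ℤ) : ℚ)]) * (⟨-1/2, 3/2, -1/2, -1/2⟩ : ℍ[ℚ,((-1 : ℤ) : ℚ),((3 : ℤ) : ℚ)]) ^ 1 - ⟨1/2, 1/2, 1/2, -1/2⟩ =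
      ⟨((-2 : ℤ) : ℚ), ((3 : ℤ) : ℚ), ((-2 : ℤ) : ℚ), ((-1 : ℤ) : ℚ)⟩ := by
    rw [pow_one, h1, QuaternionAlgebra.mk_add_mk, QuaternionAlgebra.mk_mul_mk, QuaternionAlgebra.mk_sub_mk]; ext <;> norm_num
  have vff : (⟨1/2, 1/2, 1/2, -1/2⟩ + 1 : ℍ[ℚ,((-1 : ℤ) : ℚ),((3 : ℤ) : ℚ)]) * (⟨-1/2, 3/2, -1/2, -1/2⟩ : ℍ[ℚ,((-1 : ℤ) : ℚ),((3 : ℤ) : ℚ)]) ^ 0 - (⟨1/2, 1/2, 1/2, -1/2⟩ + 1) =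
      ⟨((0 : ℤ) : ℚ), ((0 : ℤ) : ℚ), ((0 : ℤ) : ℚ), ((0 : ℤ) : ℚ)⟩ := by
    rw [pow_zero, mul_one, sub_self]; ext <;> norm_num
  rw [v11] at t11; rw [v1e] at t1e; rw [v1f] at t1f; rw [ve1] at te1; rw [vee] at tee; rw [vef] at tef
  rw [vf1] at tf1; rw [vfe] at tfe; rw [vff] at tff
  -- the classes of `z` and `x` (the class `0` is excluded by the odd norms); `x − e − 1 = x − (e + 1)`
  have hsub : ∀ y : ℍ[ℚ,((-1 : ℤ) : ℚ),((3 : ℤ) : ℚ)], y - ⟨1/2, 1/2, 1/2, -1/2⟩ - 1 = y - (⟨1/2, 1/2, 1/2, -1/2⟩ + 1) := fun y ↦ by rw [sub_sub]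
  rcases primeTwo_cases hz with hz0 | hz1 | hze | hzf
  · exact absurd hz0.2 (hodd hzM)
  · rcases primeTwo_cases hx with hx0 | hx1 | hxe | hxf
    · exact absurd hx0.2 (hodd hxM)
    · exact ⟨0, by norm_num, t11 hz1 hx1 (mem 0 0 0 0 ⟨0, by norm_num⟩)⟩
    · exact ⟨2, le_rfl, t1e hz1 hxe (mem (-1) (-2) 0 1 ⟨-1, by norm_num⟩)⟩
    · rw [hsub] at hxf
      exact ⟨1, by norm_num, t1f hz1 hxf (mem (-2) 1 (-1) 0 ⟨-1, by norm_num⟩)⟩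
  · rcases primeTwo_cases hx with hx0 | hx1 | hxe | hxf
    · exact absurd hx0.2 (hodd hxM)
    · exact ⟨1, by norm_num, te1 hze hx1 (mem (-2) 2 (-1) (-1) ⟨-1, by norm_num⟩)⟩
    · exact ⟨0, by norm_num, tee hze hxe (mem 0 0 0 0 ⟨0, by norm_num⟩)⟩
    · rw [hsub] at hxf
      exact ⟨2, le_rfl, tef hze hxf (mem (-1) (-3) 0 2 ⟨-1, by norm_num⟩)⟩
  · rw [hsub] at hzf
    rcases primeTwo_cases hx with hx0 | hx1 | hxe | hxf
    · exact absurd hx0.2 (hodd hxM)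
    · exact ⟨2, le_rfl, tf1 hzf hx1 (mem (-1) (-4) 1 2 ⟨-1, by norm_num⟩)⟩
    · exact ⟨1, by norm_num, tfe hzf hxe (mem (-2) 3 (-2) (-1) ⟨-1, by norm_num⟩)⟩
    · rw [hsub] at hxf
      exact ⟨0, by norm_num, tff hzf hxf (mem 0 0 0 0 ⟨0, by norm_num⟩)⟩

end TransportTwo

/-! ## §3 Transport modulo `P₃` by powers of `i` -/

section TransportThree

/-- In `𝔽₉ = 𝔽₃(i)`, two elements of the same NON-ZERO norm `a² + b² = c² + d²` differ by a factor `i^k`: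
`(a, b) ∈ {(c, d), (−d, c), (−c, −d), (d, −c)}`. [cite: VignerasLNM800, Ch. II §1 Lemme 1.8 (residue field `𝔽₉`)] -/
private theorem zmod3_same_norm (a b c d : ZMod 3) (h0 : a ^ 2 + b ^ 2 ≠ 0) (h : a ^ 2 + b ^ 2 = c ^ 2 + d ^ 2) :
    (a = c ∧ b = d) ∨ (a = -d ∧ b = c) ∨ (a = -c ∧ b = -d) ∨ (a = d ∧ b = -c) := by
  revert a b c d
  decide

/-- `(r + si)·i^k` for `k = 0, 1, 2, 3`, as integer representatives. [cite: VignerasLNM800, Ch. II §1 Cor. 1.7] -/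
private theorem intInt_mul_i_pow (r s : ℤ) :
    ((⟨r, s, 0, 0⟩ : ℍ[ℚ,((-1 : ℤ) : ℚ),((3 : ℤ) : ℚ)]) * (⟨0, 1, 0, 0⟩ : ℍ[ℚ,((-1 : ℤ) : ℚ),((3 : ℤ) : ℚ)]) ^ 0 = ⟨((r : ℤ) : ℚ), ((s : ℤ) : ℚ), 0, 0⟩) ∧
    ((⟨r, s, 0, 0⟩ : ℍ[ℚ,((-1 : ℤ) : ℚ),((3 : ℤ) : ℚ)]) * (⟨0, 1, 0, 0⟩ : ℍ[ℚ,((-1 : ℤ) : ℚ),((3 : ℤ) : ℚ)]) ^ 1 = ⟨((-s : ℤ) : ℚ), ((r : ℤ) : ℚ), 0, 0⟩) ∧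
    ((⟨r, s, 0, 0⟩ : ℍ[ℚ,((-1 : ℤ) : ℚ),((3 : ℤ) : ℚ)]) * (⟨0, 1, 0, 0⟩ : ℍ[ℚ,((-1 : ℤ) : ℚ),((3 : ℤ) : ℚ)]) ^ 2 = ⟨((-r : ℤ) : ℚ), ((-s : ℤ) : ℚ), 0, 0⟩) ∧
    ((⟨r, s, 0, 0⟩ : ℍ[ℚ,((-1 : ℤ) : ℚ),((3 : ℤ) : ℚ)]) * (⟨0, 1, 0, 0⟩ : ℍ[ℚ,((-1 : ℤ) : ℚ),((3 : ℤ) : ℚ)]) ^ 3 = ⟨((s : ℤ) : ℚ), ((-r : ℤ) : ℚ), 0, 0⟩) := by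
  have i2 : (⟨0, 1, 0, 0⟩ : ℍ[ℚ,((-1 : ℤ) : ℚ),((3 : ℤ) : ℚ)]) ^ 2 = ⟨-1, 0, 0, 0⟩ := by
    rw [pow_two, QuaternionAlgebra.mk_mul_mk]; ext <;> norm_num
  have i3 : (⟨0, 1, 0, 0⟩ : ℍ[ℚ,((-1 : ℤ) : ℚ),((3 : ℤ) : ℚ)]) ^ 3 = ⟨0, -1, 0, 0⟩ := by
    rw [pow_succ, i2, QuaternionAlgebra.mk_mul_mk]; ext <;> norm_num
  refine ⟨by rw [pow_zero, mul_one], ?_, ?_, ?_⟩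
  · rw [pow_one, QuaternionAlgebra.mk_mul_mk]; ext <;> push_cast <;> ring
  · rw [i2, QuaternionAlgebra.mk_mul_mk]; ext <;> push_cast <;> ring
  · rw [i3, QuaternionAlgebra.mk_mul_mk]; ext <;> push_cast <;> ring

/-- **TRANSPORT MOD `P₃`: for `x, z ∈ O₆` with `nr x ≡ nr z ≢ 0 (mod 3)` there is `b ≤ 3` with `z·i^b − x ∈ P₃`** (in
`(O₆/P₃)^× = 𝔽₉^×` the elements of a given non-zero norm `N_{𝔽₉/𝔽₃}` form a coset of the norm-one circle `{±1, ±i}`).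
[cite: VignerasLNM800, Ch. II §1 Cor. 1.7 and Lemme 1.8 (residue field `𝔽₉` at the ramified prime `3`)] [cite: KudlaRapoportYang2006, §3.4 (3.4.19)] -/
theorem exists_pow_i_congr_primeThree {x z : ℍ[ℚ,((-1 : ℤ) : ℚ),((3 : ℤ) : ℚ)]} {M M' : ℤ}
    (hx : x ∈ order (-1) 3 ∨ x - ⟨1/2, 1/2, 1/2, -1/2⟩ ∈ order (-1) 3) (hM : (x * star x).re = M) (h3 : ¬ (3 : ℤ) ∣ M)
    (hz : z ∈ order (-1) 3 ∨ z - ⟨1/2, 1/2, 1/2, -1/2⟩ ∈ order (-1) 3) (hM' : (z * star z).re = M') (hMM' : (3 : ℤ) ∣ M' - M) :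
    ∃ b : ℕ, b ≤ 3 ∧
      ((z * (⟨0, 1, 0, 0⟩ : ℍ[ℚ,((-1 : ℤ) : ℚ),((3 : ℤ) : ℚ)]) ^ b - x ∈ order (-1) 3 ∨ z * (⟨0, 1, 0, 0⟩ : ℍ[ℚ,((-1 : ℤ) : ℚ),((3 : ℤ) : ℚ)]) ^ b - x - ⟨1/2, 1/2, 1/2, -1/2⟩ ∈ order (-1) 3) ∧
        ∃ N : ℤ, ((z * (⟨0, 1, 0, 0⟩ : ℍ[ℚ,((-1 : ℤ) : ℚ),((3 : ℤ) : ℚ)]) ^ b - x) * star (z * (⟨0, 1, 0, 0⟩ : ℍ[ℚ,((-1 : ℤ) : ℚ),((3 : ℤ) : ℚ)]) ^ b - x)).re = 3 * N) := by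
  obtain ⟨r, s, hxc⟩ := exists_int_int_sub_mem_primeThree hx
  obtain ⟨r', s', hzc⟩ := exists_int_int_sub_mem_primeThree hz
  have hxn := three_dvd_norm_sub_of_primeThree hx hM hxc
  have hzn := three_dvd_norm_sub_of_primeThree hz hM' hzc
  have hiO : (⟨0, 1, 0, 0⟩ : ℍ[ℚ,((-1 : ℤ) : ℚ),((3 : ℤ) : ℚ)]) ∈ order (-1) 3 := ⟨![0, 1, 0, 0], by ext <;> simp [ofCoords]⟩
  -- to `ZMod 3`
  have cast_eq : ∀ {u v : ℤ}, (3 : ℤ) ∣ u - v → ((u : ZMod 3)) = v := fun {u v} h ↦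
    ((ZMod.intCast_eq_intCast_iff_dvd_sub v u 3).2 (by simpa using h)).symm
  have ha : ((r : ZMod 3)) ^ 2 + (s : ZMod 3) ^ 2 = (M : ZMod 3) := by
    have := cast_eq hxn; push_cast at this; exact this.symm
  have hc : ((r' : ZMod 3)) ^ 2 + (s' : ZMod 3) ^ 2 = (M' : ZMod 3) := by
    have := cast_eq hzn; push_cast at this; exact this.symm
  have hMc : ((M' : ZMod 3)) = M := cast_eq hMM'
  have h0 : ((r : ZMod 3)) ^ 2 + (s : ZMod 3) ^ 2 ≠ 0 := by
    rw [ha]; intro h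
    exact h3 ((ZMod.intCast_zmod_eq_zero_iff_dvd M 3).1 h)
  have key := zmod3_same_norm (r : ZMod 3) (s : ZMod 3) (r' : ZMod 3) (s' : ZMod 3) h0 (by rw [ha, hc, hMc])
  obtain ⟨m0, m1, m2, m3⟩ := intInt_mul_i_pow r' s'
  -- back to divisibilities
  have dv : ∀ {u v : ℤ}, ((u : ZMod 3)) = v → (3 : ℤ) ∣ v - u := fun {u v} h ↦ by
    simpa using (ZMod.intCast_eq_intCast_iff_dvd_sub u v 3).1 h
  -- assembling `z i^b − x = (z − c_z) i^b + (c_z i^b − c_x) − (x − c_x)`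
  have assemble : ∀ (b : ℕ) (r'' s'' : ℤ),
      (⟨r', s', 0, 0⟩ : ℍ[ℚ,((-1 : ℤ) : ℚ),((3 : ℤ) : ℚ)]) * (⟨0, 1, 0, 0⟩ : ℍ[ℚ,((-1 : ℤ) : ℚ),((3 : ℤ) : ℚ)]) ^ b = ⟨((r'' : ℤ) : ℚ), ((s'' : ℤ) : ℚ), 0, 0⟩ →
      (3 : ℤ) ∣ r'' - r → (3 : ℤ) ∣ s'' - s →
      ((z * (⟨0, 1, 0, 0⟩ : ℍ[ℚ,((-1 : ℤ) : ℚ),((3 : ℤ) : ℚ)]) ^ b - x ∈ order (-1) 3 ∨ z * (⟨0, 1, 0, 0⟩ : ℍ[ℚ,((-1 : ℤ) : ℚ),((3 : ℤ) : ℚ)]) ^ b - x - ⟨1/2, 1/2, 1/2, -1/2⟩ ∈ order (-1) 3) ∧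
        ∃ N : ℤ, ((z * (⟨0, 1, 0, 0⟩ : ℍ[ℚ,((-1 : ℤ) : ℚ),((3 : ℤ) : ℚ)]) ^ b - x) * star (z * (⟨0, 1, 0, 0⟩ : ℍ[ℚ,((-1 : ℤ) : ℚ),((3 : ℤ) : ℚ)]) ^ b - x)).re = 3 * N) := by
    intro b r'' s'' hm hr hs
    have e : z * (⟨0, 1, 0, 0⟩ : ℍ[ℚ,((-1 : ℤ) : ℚ),((3 : ℤ) : ℚ)]) ^ b - x =
        (z - ⟨r', s', 0, 0⟩) * (⟨0, 1, 0, 0⟩ : ℍ[ℚ,((-1 : ℤ) : ℚ),((3 : ℤ) : ℚ)]) ^ b + ((⟨r', s', 0, 0⟩ : ℍ[ℚ,((-1 : ℤ) : ℚ),((3 : ℤ) : ℚ)]) * (⟨0, 1, 0, 0⟩ : ℍ[ℚ,((-1 : ℤ) : ℚ),((3 : ℤ) : ℚ)]) ^ b - ⟨r, s, 0, 0⟩)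
          + -(x - ⟨r, s, 0, 0⟩) := by
      noncomm_ring
    rw [e, hm]
    refine primeThree_add (primeThree_add (maxOrder_mul_primeThree (Or.inl (Subring.pow_mem _ hiO b)) hzc).2 ?_)
      (primeThree_neg hxc)
    have := (intInt_sub_intInt_primeThree_iff r'' s'' r s).2 ⟨hr, hs⟩
    push_cast at this ⊢
    exact this
  rcases key with ⟨e1, e2⟩ | ⟨e1, e2⟩ | ⟨e1, e2⟩ | ⟨e1, e2⟩
  · exact ⟨0, by norm_num, assemble 0 r' s' m0 (dv e1) (dv e2)⟩
  · refine ⟨1, by norm_num, assemble 1 (-s') r' m1 (dv ?_) (dv e2)⟩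
    rw [Int.cast_neg]; exact e1
  · refine ⟨2, by norm_num, assemble 2 (-r') (-s') m2 (dv ?_) (dv ?_)⟩
    · rw [Int.cast_neg]; exact e1
    · rw [Int.cast_neg]; exact e2
  · refine ⟨3, le_rfl, assemble 3 s' (-r') m3 (dv e1) (dv ?_)⟩
    rw [Int.cast_neg]; exact e2

end TransportThree

/-! ## §4 Eichler's Norm Theorem for `I = P₂`, `P₃`, `P₂P₃` -/

section Eichler

/-- **`nrd(x + P₂) = nrd(x) + 2ℤ` for `x ∈ O₆` of odd norm `M`** — Lemma 3.1 (iii) for `I = P₂` (`nrd(P₂) = 2`,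
`P₂ ∩ ℤ = 2ℤ`): the set of norms of the coset `x + P₂` is EXACTLY the odd integers. `⊆`: `x + y ∉ P₂`; `⊇`: a `z ∈ O₆` with
`nr z = n` (Lemma 3.1 (ii), g33-#3) transported into `x + P₂` by `f^a` (§2).
[cite: CerriChaubertLezowski2014, Lemma 3.1 (iii) (= Eichler, Satz 5) and Lemma 3.7 (proof: `P_i ∩ ℤ_K = p_i`, `nrd(P_i) = p_i`), for `K = ℚ`, `Λ = O₆`, `I = P₂`] -/
theorem norm_add_primeTwo_eq {x : ℍ[ℚ,((-1 : ℤ) : ℚ),((3 : ℤ) : ℚ)]} {M : ℤ}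
    (hx : x ∈ order (-1) 3 ∨ x - ⟨1/2, 1/2, 1/2, -1/2⟩ ∈ order (-1) 3) (hM : (x * star x).re = M) (h2 : ¬ (2 : ℤ) ∣ M) :
    {n : ℤ | ∃ y : ℍ[ℚ,((-1 : ℤ) : ℚ),((3 : ℤ) : ℚ)], ((y ∈ order (-1) 3 ∨ y - ⟨1/2, 1/2, 1/2, -1/2⟩ ∈ order (-1) 3) ∧ ∃ N : ℤ, (y * star y).re = 2 * N) ∧
        ((x + y) * star (x + y)).re = n} = {n : ℤ | (2 : ℤ) ∣ n - M} := by
  ext n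
  simp only [Set.mem_setOf_eq]
  constructor
  · rintro ⟨y, hy, hn⟩
    -- `x + y ∉ P₂` (else `x ∈ P₂`), so `n` is odd like `M`
    by_contra hcon
    have hn2 : (2 : ℤ) ∣ n := by omega
    obtain ⟨k, hk⟩ := hn2
    have hxy : ((x + y ∈ order (-1) 3 ∨ x + y - ⟨1/2, 1/2, 1/2, -1/2⟩ ∈ order (-1) 3) ∧
        ∃ N : ℤ, ((x + y) * star (x + y)).re = 2 * N) :=
      ⟨maxOrder_add hx hy.1, k, by rw [hn, hk]; push_cast; ring⟩
    have hxP := primeTwo_add hxy (primeTwo_neg hy)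
    rw [add_neg_cancel_right] at hxP
    obtain ⟨N, hN⟩ := hxP.2
    exact h2 ⟨N, by exact_mod_cast hM.symm.trans hN⟩
  · intro hn
    obtain ⟨z, hz, hzn⟩ := exists_maxOrder_norm_eq n
    have hxodd : ∃ M₀ : ℤ, (x * star x).re = 2 * M₀ + 1 :=
      ⟨(M - 1) / 2, by rw [hM]; exact_mod_cast (by omega : M = 2 * ((M - 1) / 2) + 1)⟩
    have hzodd : ∃ M₀ : ℤ, (z * star z).re = 2 * M₀ + 1 :=
      ⟨(n - 1) / 2, by rw [hzn]; exact_mod_cast (by omega : n = 2 * ((n - 1) / 2) + 1)⟩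
    obtain ⟨a, -, hP⟩ := exists_pow_f_congr_primeTwo hx hxodd hz hzodd
    refine ⟨z * (⟨-1/2, 3/2, -1/2, -1/2⟩ : ℍ[ℚ,((-1 : ℤ) : ℚ),((3 : ℤ) : ℚ)]) ^ a - x, hP, ?_⟩
    rw [add_sub_cancel, re_mul_mul_star_mul, (pow_f_i_maxOrder_normOne a 0).1.2, mul_one, hzn]

/-- **`nrd(x + P₃) = nrd(x) + 3ℤ` for `x ∈ O₆` with `3 ∤ nr x = M`** — Lemma 3.1 (iii) for `I = P₃` (`nrd(P₃) = 3`,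
`P₃ ∩ ℤ = 3ℤ`). `⊆`: `x + y ≡ x ≡ r + si (mod P₃)` and `nr ≡ r² + s² (mod 3)` (g31-#5); `⊇`: transport by `i^b` (§3).
[cite: CerriChaubertLezowski2014, Lemma 3.1 (iii) (= Eichler, Satz 5), for `K = ℚ`, `Λ = O₆`, `I = P₃`] [cite: VignerasLNM800, Ch. II §1 Cor. 1.7] -/
theorem norm_add_primeThree_eq {x : ℍ[ℚ,((-1 : ℤ) : ℚ),((3 : ℤ) : ℚ)]} {M : ℤ}
    (hx : x ∈ order (-1) 3 ∨ x - ⟨1/2, 1/2, 1/2, -1/2⟩ ∈ order (-1) 3) (hM : (x * star x).re = M) (h3 : ¬ (3 : ℤ) ∣ M) :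
    {n : ℤ | ∃ y : ℍ[ℚ,((-1 : ℤ) : ℚ),((3 : ℤ) : ℚ)], ((y ∈ order (-1) 3 ∨ y - ⟨1/2, 1/2, 1/2, -1/2⟩ ∈ order (-1) 3) ∧ ∃ N : ℤ, (y * star y).re = 3 * N) ∧
        ((x + y) * star (x + y)).re = n} = {n : ℤ | (3 : ℤ) ∣ n - M} := by
  ext n
  simp only [Set.mem_setOf_eq]
  constructor
  · rintro ⟨y, hy, hn⟩
    obtain ⟨r, s, hxc⟩ := exists_int_int_sub_mem_primeThree hx
    have hxyc : ((x + y - ⟨r, s, 0, 0⟩ ∈ order (-1) 3 ∨ x + y - ⟨r, s, 0, 0⟩ - ⟨1/2, 1/2, 1/2, -1/2⟩ ∈ order (-1) 3) ∧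
        ∃ N : ℤ, ((x + y - ⟨r, s, 0, 0⟩) * star (x + y - ⟨r, s, 0, 0⟩)).re = 3 * N) := by
      have e : x + y - ⟨r, s, 0, 0⟩ = (x - ⟨r, s, 0, 0⟩) + y := by abel
      rw [e]; exact primeThree_add hxc hy
    have h1 := three_dvd_norm_sub_of_primeThree hx hM hxc
    have h2 := three_dvd_norm_sub_of_primeThree (maxOrder_add hx hy.1) hn hxyc
    have := dvd_sub h2 h1
    rwa [sub_sub_sub_cancel_right] at this
  · intro hn
    obtain ⟨z, hz, hzn⟩ := exists_maxOrder_norm_eq n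
    obtain ⟨b, -, hP⟩ := exists_pow_i_congr_primeThree hx hM h3 hz hzn hn
    refine ⟨z * (⟨0, 1, 0, 0⟩ : ℍ[ℚ,((-1 : ℤ) : ℚ),((3 : ℤ) : ℚ)]) ^ b - x, hP, ?_⟩
    rw [add_sub_cancel, re_mul_mul_star_mul, (pow_f_i_maxOrder_normOne 0 b).2.2, mul_one, hzn]

/-- **`nrd(x + P₂P₃) = nrd(x) + 6ℤ` for `x ∈ O₆` with `(nr x, 6) = 1`** — Lemma 3.1 (iii) for `I = P₂P₃ = (δ) = 𝔇(O₆)`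
(`P₂P₃ = P₂ ∩ P₃ = {y ∈ O₆ : 6 ∣ nr y}`, g31-#6; `nrd = 6`, `∩ ℤ = 6ℤ`): transport by `i^b` (fixing the class mod `P₃`,
trivial mod `P₂`) and then by `f^a` (fixing the class mod `P₂`, trivial mod `P₃`) — the proof of Lemma 3.7's
«`P_iP_j = P_jP_i`, `P₁⋯P_s ∩ ℤ_K ⊆ p₁⋯p_s`» made effective. [cite: CerriChaubertLezowski2014, Lemma 3.1 (iii) and Lemma 3.7 (proof, (6)), for `K = ℚ`, `Λ = O₆`, `I = P₂P₃`] [cite: KudlaRapoportYang2006, §3.4 (3.4.19) («`O_B/(δ)`»)] -/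
theorem norm_add_primeSix_eq {x : ℍ[ℚ,((-1 : ℤ) : ℚ),((3 : ℤ) : ℚ)]} {M : ℤ}
    (hx : x ∈ order (-1) 3 ∨ x - ⟨1/2, 1/2, 1/2, -1/2⟩ ∈ order (-1) 3) (hM : (x * star x).re = M) (h2 : ¬ (2 : ℤ) ∣ M)
    (h3 : ¬ (3 : ℤ) ∣ M) :
    {n : ℤ | ∃ y : ℍ[ℚ,((-1 : ℤ) : ℚ),((3 : ℤ) : ℚ)], ((y ∈ order (-1) 3 ∨ y - ⟨1/2, 1/2, 1/2, -1/2⟩ ∈ order (-1) 3) ∧ ∃ N : ℤ, (y * star y).re = 6 * N) ∧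
        ((x + y) * star (x + y)).re = n} = {n : ℤ | (6 : ℤ) ∣ n - M} := by
  ext n
  simp only [Set.mem_setOf_eq]
  constructor
  · rintro ⟨y, hy, hn⟩
    obtain ⟨hy2, hy3⟩ := (primeSix_iff y).1 hy
    have e2 : (2 : ℤ) ∣ n - M := by
      have : n ∈ {n : ℤ | ∃ y : ℍ[ℚ,((-1 : ℤ) : ℚ),((3 : ℤ) : ℚ)], ((y ∈ order (-1) 3 ∨ y - ⟨1/2, 1/2, 1/2, -1/2⟩ ∈ order (-1) 3) ∧
          ∃ N : ℤ, (y * star y).re = 2 * N) ∧ ((x + y) * star (x + y)).re = n} := ⟨y, hy2, hn⟩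
      rw [norm_add_primeTwo_eq hx hM h2] at this
      exact this
    have e3 : (3 : ℤ) ∣ n - M := by
      have : n ∈ {n : ℤ | ∃ y : ℍ[ℚ,((-1 : ℤ) : ℚ),((3 : ℤ) : ℚ)], ((y ∈ order (-1) 3 ∨ y - ⟨1/2, 1/2, 1/2, -1/2⟩ ∈ order (-1) 3) ∧
          ∃ N : ℤ, (y * star y).re = 3 * N) ∧ ((x + y) * star (x + y)).re = n} := ⟨y, hy3, hn⟩
      rw [norm_add_primeThree_eq hx hM h3] at this
      exact this
    omega
  · intro hn
    obtain ⟨z, hz, hzn⟩ := exists_maxOrder_norm_eq n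
    -- first mod `P₃` by `i^b`, then mod `P₂` by `f^a`
    obtain ⟨b, -, hP3⟩ := exists_pow_i_congr_primeThree hx hM h3 hz hzn (by omega)
    set z₁ : ℍ[ℚ,((-1 : ℤ) : ℚ),((3 : ℤ) : ℚ)] := z * (⟨0, 1, 0, 0⟩ : ℍ[ℚ,((-1 : ℤ) : ℚ),((3 : ℤ) : ℚ)]) ^ b with hz₁
    have hz₁O : z₁ ∈ order (-1) 3 ∨ z₁ - ⟨1/2, 1/2, 1/2, -1/2⟩ ∈ order (-1) 3 :=
      maxOrder_mul hz (Or.inl (pow_f_i_maxOrder_normOne 0 b).2.1)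
    have hz₁n : (z₁ * star z₁).re = n := by
      rw [hz₁, re_mul_mul_star_mul, (pow_f_i_maxOrder_normOne 0 b).2.2, mul_one, hzn]
    have hxodd : ∃ M₀ : ℤ, (x * star x).re = 2 * M₀ + 1 :=
      ⟨(M - 1) / 2, by rw [hM]; exact_mod_cast (by omega : M = 2 * ((M - 1) / 2) + 1)⟩
    have hzodd : ∃ M₀ : ℤ, (z₁ * star z₁).re = 2 * M₀ + 1 :=
      ⟨(n - 1) / 2, by rw [hz₁n]; exact_mod_cast (by omega : n = 2 * ((n - 1) / 2) + 1)⟩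
    obtain ⟨a, -, hP2⟩ := exists_pow_f_congr_primeTwo hx hxodd hz₁O hzodd
    refine ⟨z₁ * (⟨-1/2, 3/2, -1/2, -1/2⟩ : ℍ[ℚ,((-1 : ℤ) : ℚ),((3 : ℤ) : ℚ)]) ^ a - x, (primeSix_iff _).2 ⟨hP2, ?_⟩, ?_⟩
    · -- mod `P₃`: `z₁ f^a − x = (z₁ − x) f^a + x (f^a − 1)`
      have e : z₁ * (⟨-1/2, 3/2, -1/2, -1/2⟩ : ℍ[ℚ,((-1 : ℤ) : ℚ),((3 : ℤ) : ℚ)]) ^ a - x = (z₁ - x) * (⟨-1/2, 3/2, -1/2, -1/2⟩ : ℍ[ℚ,((-1 : ℤ) : ℚ),((3 : ℤ) : ℚ)]) ^ a + x * ((⟨-1/2, 3/2, -1/2, -1/2⟩ : ℍ[ℚ,((-1 : ℤ) : ℚ),((3 : ℤ) : ℚ)]) ^ a - 1) := by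
        noncomm_ring
      rw [e]
      exact primeThree_add (maxOrder_mul_primeThree (pow_f_i_maxOrder_normOne a 0).1.1 hP3).2
        (maxOrder_mul_primeThree hx (primeThree_pow_f_sub_one a)).1
    · rw [add_sub_cancel, re_mul_mul_star_mul, (pow_f_i_maxOrder_normOne a 0).1.2, mul_one, hz₁n]

end Eichler


end Literature.Geometry.Kaehler.ComplexTorus.QuaternionType
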